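import Mathlib.RingTheory.Valuation.Basic
import Mathlib.Algebra.Order.GroupWithZero.Canonical
import Mathlib.Algebra.GroupWithZero.WithZero
import HarnessLib

/-!
# Additive classes X3/X4 at `p = 3`: the `3`-adic lift (Tate's algorithm for tame `I₀*`, step 1)

HONEST FRAMING (cell `b2b-bsdres`, run/shared/lean/b2b/bsd-rank1-residual/, verbatim in every
file): the goal of the cell is to DELETE the COMBINATION-SHAPED residual classes of the
Birch–Swinnerton-Dyer formula for ALL analytic-rank `≤ 1` elliptic curves over `ℚ` — "full BSD
formula for every rank `≤ 1` curve in class `C`" assembled STRICTLY from published theorems — so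
that the rank-`≤ 1` remainder becomes exactly the CONSTRUCTION-SHAPED classes, which are TYPED
(missing-input `Prop`s), NOT attempted. This is not "finishing BSD". Sub-cell `additive-p2`
(CLASS-OWNERS row "X3/X4 additive — pot. good ordinary / X3♯(G-ord)"), generation 7: research
route; no claim beyond the stated classes; theorems only, no definition, no named fact;
X3♯(G-ord)/X4♯(G-ord) stay CONSTRUCTION-SHAPED.

PURPOSE. The sub-cell's kernel dictionary "census data ⟺ Delbourgo's hypothesis (G)" is complete
at every `p ≥ 5` (gens 0–6) but at `p = 3` the class theorems
(`GordDescentFreeFieldThree.lean`, `GordDescentModelFreeThree.lean`) still carry the DATUM "every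
globally minimal model of the twist `E^{(−3)}` has good reduction at `3`": at `p = 3` the valuation
criterion `12 ∣ ord(Δ)` (Silverman *AEC* VII.5.1, residue characteristic `≥ 5`) is not available
(wild ramification), and gen 5 recorded the implication `TypeG W 3 ∧ Addv W 3 ⇒ E^{(−3)} good at 3`
as needing "a Néron–Ogg–Shafarevich-type input the tree lacks". Generation 7 proves it WITHOUT any
Galois-representation input, by running the relevant step of Tate's algorithm in the kernel
(sibling file `TypeGThree.lean`). This file is the valuation-theoretic core, stated abstractly.

THE LEMMA (`ThreeAdicLift.exists_rat_of_integrality`). Setting: a field `L` with a valuation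
`v : L → ℤᵐ⁰` and a ring map `ι : ℚ → L` such that `v ∘ ι = v₃²` for a valuation `v₃` of `ℚ` with
`v₃(3) = exp(−1)`, `v₃(2) = 1`, `v₃(ℤ) ≤ 1` — i.e. `v` has ramification index `2` over the `3`-adic
valuation (in the application: `L = K_𝔓`, `K = ℚ(ζ₃)`, `𝔓 = (√−3)`) — and such that every
`v`-integer is congruent to a rational integer modulo the maximal ideal (residue field `𝔽₃`). Let
`b₂, b₄, b₆ ∈ ℚ` be `3`-integral (the `b`-invariants of an integral model `W/ℚ`) and let `r ∈ L`
satisfy the three integrality conditions of a model `(u, r, s, t) • W` with `v(u) = exp(−k)`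
(Silverman *AEC* III.1, Table 3.1: `u²b₂' = b₂ + 12r`, `u⁴b₄' = b₄ + rb₂ + 6r²`,
`u⁶b₆' = b₆ + 2rb₄ + r²b₂ + 4r³`):
`v(b₂ + 12r) ≤ exp(−2k)`, `v(b₄ + rb₂ + 6r²) ≤ exp(−4k)`, `v(b₆ + 2rb₄ + r²b₂ + 4r³) ≤ exp(−6k)`.
THEN there is a RATIONAL `ρ`, `v₃(ρ) ≤ 1`, with
`v₃(b₂ + 12ρ) ≤ exp(−k)`, `v₃(b₄ + ρb₂ + 6ρ²) ≤ exp(−2k)`, `v₃(b₆ + 2ρb₄ + ρ²b₂ + 4ρ³) ≤ exp(−3k)` —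
the same conditions over `ℚ` with HALF the exponents (the most `ℚ` can see, `v(ℚ×) = exp(2ℤ)`).
Proof (elementary; the `p = 3` analogue of "translate `x` by a third of the triple root"):
`v(r) ≤ 1` (else `4r³` dominates); by induction on `m ≤ k` there is a rational `ρ_m` with
`v(ι ρ_m − r) ≤ exp(−2m)`: a RESIDUE LIFT (`(ι ρ_m − r)/3^m` is congruent to an integer `c`;
`ρ_{m}' = ρ_m − 3^m c` gains `exp(−1)`) followed by a PARITY STEP (if `v(ι ρ' − r)` were exactly
`exp(−(2m+1))`, the Taylor expansion `g(ρ') = B₆ + 2B₄δ + B₂δ² + 4δ³` of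
`g(x) = 4x³ + b₂x² + 2b₄x + b₆` at `r`, `δ = ι ρ' − r`, would have valuation exactly
`v(4δ³) = exp(−(6m+3))` for `m < k`, but `g(ρ') ∈ ℚ` has square valuation); at `m = k` the three
conditions transfer from `r` to `ρ`. Used with `k = ord₃(Δ_min)/6` in `TypeGThree.lean`: `k ≥ 2`
contradicts minimality of `W` at `3`, and `k = 1` produces the good model
`(3, −3ρ, 0, 0) • W^{(−3)}` of the twist.

Also: `le_exp_sub_one_of_lt_exp` (discreteness of `ℤᵐ⁰`), `sq_ne_exp_odd`,
`le_exp_of_sq_le_exp_two_mul`.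

References: J. H. Silverman, *AEC* III.1 Table 3.1, VII.1; J. Tate, "Algorithm for determining the
type of a singular fiber in an elliptic pencil", Antwerp IV, LNM 476 (1975) §7–8 (case `I₀*`);
A. Kraus, Manuscripta Math. 69 (1990) (`p = 3`).
-/

noncomputable section

open WithZero Multiplicative

namespace Summit.BirchSwinnertonDyer.Rank1Residual.Additive

namespace ThreeAdicLift

/-- Discreteness of `ℤᵐ⁰`: `x < exp n` forces `x ≤ exp (n - 1)`. -/
theorem le_exp_sub_one_of_lt_exp {x : ℤᵐ⁰} {n : ℤ} (h : x < exp n) : x ≤ exp (n - 1) := by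
  by_cases hx : x = 0
  · rw [hx]; exact zero_le
  · rw [← exp_log hx] at h ⊢
    rw [exp_lt_exp] at h
    rw [exp_le_exp]
    omega

/-- In `ℤᵐ⁰` a square is never `exp` of an odd integer. -/
theorem sq_ne_exp_odd (x : ℤᵐ⁰) (n : ℤ) : x ^ 2 ≠ exp (2 * n + 1) := by
  intro h
  by_cases hx : x = 0
  · rw [hx, zero_pow two_ne_zero] at h
    exact exp_ne_zero h.symm
  · rw [← exp_log hx, ← exp_nsmul, exp_inj] at h
    simp only [nsmul_eq_mul, Nat.cast_ofNat] at h
    omega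

/-- In `ℤᵐ⁰`: `x ^ 2 ≤ exp (2 n)` implies `x ≤ exp n`. -/
theorem le_exp_of_sq_le_exp_two_mul {x : ℤᵐ⁰} {n : ℤ} (h : x ^ 2 ≤ exp (2 * n)) : x ≤ exp n := by
  have h' : x ^ 2 ≤ exp n ^ 2 := by rwa [← exp_nsmul, nsmul_eq_mul, Nat.cast_ofNat]
  exact le_of_pow_le_pow_left₀ two_ne_zero zero_le h'

variable {L : Type*} [Field L] (v : Valuation L ℤᵐ⁰) (ι : ℚ →+* L) (v₃ : Valuation ℚ ℤᵐ⁰)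

/-- **The `3`-adic lift.** Abstract setting: `L` a field with a `ℤᵐ⁰`-valued valuation `v`
receiving `ℚ` by `ι`, such that `v ∘ ι = v₃²` for a valuation `v₃` of `ℚ` with `v₃(3) = exp(−1)`,
`v₃(2) = 1`, `v₃(ℤ) ≤ 1` (ramification index `2` over the `3`-adic valuation), and every
`v`-integer of `L` is congruent to a rational integer modulo the maximal ideal (residue field `𝔽₃`).
If `b₂, b₄, b₆ ∈ ℚ` are `3`-integral and `r ∈ L` satisfies
`v(b₂ + 12 r) ≤ exp(−2k)`, `v(b₄ + r b₂ + 6 r²) ≤ exp(−4k)`, `v(b₆ + 2 r b₄ + r² b₂ + 4 r³) ≤ exp(−6k)`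
(the integrality conditions of the model `(u, r, *, *) • W` with `v(u) = exp(−k)`, Silverman *AEC*
III.1 Table 3.1), then some RATIONAL `ρ` with `v₃(ρ) ≤ 1` satisfies the halved conditions
`v₃(b₂ + 12 ρ) ≤ exp(−k)`, `v₃(b₄ + ρ b₂ + 6 ρ²) ≤ exp(−2k)`, `v₃(b₆ + 2 ρ b₄ + ρ² b₂ + 4 ρ³) ≤ exp(−3k)`.
Proof: `r` is approximated by rationals to order `exp(−2m)`, `m ≤ k`, alternating a residue lift
(order `2m → 2m+1`) and a parity step (`2m+1 → 2m+2`: otherwise the rational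
`g(ρ') = b₆ + 2ρ'b₄ + ρ'²b₂ + 4ρ'³` would have the odd valuation `exp(−(6m+3))`). -/
theorem exists_rat_of_integrality (hι : ∀ q : ℚ, v (ι q) = v₃ q ^ 2) (h3 : v₃ 3 = exp (-1))
    (h2 : v₃ 2 = 1) (hint : ∀ n : ℤ, v₃ n ≤ 1)
    (hres : ∀ x : L, v x ≤ 1 → ∃ c : ℤ, v (x - ι c) < 1)
    {b₂ b₄ b₆ : ℚ} (hb₂ : v₃ b₂ ≤ 1) (hb₄ : v₃ b₄ ≤ 1) (hb₆ : v₃ b₆ ≤ 1) {k : ℕ} {r : L}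
    (hB₂ : v (ι b₂ + 12 * r) ≤ exp (-(2 * k : ℤ)))
    (hB₄ : v (ι b₄ + r * ι b₂ + 6 * r ^ 2) ≤ exp (-(4 * k : ℤ)))
    (hB₆ : v (ι b₆ + 2 * r * ι b₄ + r ^ 2 * ι b₂ + 4 * r ^ 3) ≤ exp (-(6 * k : ℤ))) :
    ∃ ρ : ℚ, v₃ ρ ≤ 1 ∧ v₃ (b₂ + 12 * ρ) ≤ exp (-(k : ℤ)) ∧
      v₃ (b₄ + ρ * b₂ + 6 * ρ ^ 2) ≤ exp (-(2 * k : ℤ)) ∧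
      v₃ (b₆ + 2 * ρ * b₄ + ρ ^ 2 * b₂ + 4 * ρ ^ 3) ≤ exp (-(3 * k : ℤ)) := by
  -- valuations of the small integers in `L`
  have hv2 : v (2 : L) = 1 := by rw [← map_ofNat ι 2, hι]; simp [h2]
  have hv3 : v (3 : L) = exp (-2) := by
    rw [← map_ofNat ι 3, hι]; simp only [h3, ← exp_nsmul]; norm_num
  have hv4 : v (4 : L) = 1 := by rw [show (4 : L) = 2 * 2 by norm_num, map_mul, hv2, mul_one]
  have hv6 : v (6 : L) ≤ 1 := by
    rw [show (6 : L) = 2 * 3 by norm_num, map_mul, hv2, hv3, one_mul, ← exp_zero, exp_le_exp]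
    norm_num
  have hv12 : v (12 : L) ≤ 1 := by
    rw [show (12 : L) = 4 * 3 by norm_num, map_mul, hv4, hv3, one_mul, ← exp_zero, exp_le_exp]
    norm_num
  have hvb₂ : v (ι b₂) ≤ 1 := by rw [hι]; exact pow_le_one₀ zero_le hb₂
  have hvb₄ : v (ι b₄) ≤ 1 := by rw [hι]; exact pow_le_one₀ zero_le hb₄
  have hvb₆ : v (ι b₆) ≤ 1 := by rw [hι]; exact pow_le_one₀ zero_le hb₆
  -- abbreviations
  set B₂ := ι b₂ + 12 * r with hB₂def
  set B₄ := ι b₄ + r * ι b₂ + 6 * r ^ 2 with hB₄def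
  set B₆ := ι b₆ + 2 * r * ι b₄ + r ^ 2 * ι b₂ + 4 * r ^ 3 with hB₆def
  have hk3 : exp (-(6 * k : ℤ)) ≤ 1 := by rw [← exp_zero, exp_le_exp]; omega
  -- Taylor expansions of `g(x) = 4x³ + b₂x² + 2b₄x + b₆` around `r`, at the image of a rational `ρ`
  have taylor₂ : ∀ ρ : ℚ, ι (b₂ + 12 * ρ) = B₂ + 12 * (ι ρ - r) := fun ρ ↦ by
    rw [hB₂def]; simp only [map_add, map_mul, map_ofNat]; ring
  have taylor₄ : ∀ ρ : ℚ, ι (b₄ + ρ * b₂ + 6 * ρ ^ 2) =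
      B₄ + B₂ * (ι ρ - r) + 6 * (ι ρ - r) ^ 2 := fun ρ ↦ by
    rw [hB₄def, hB₂def]; simp only [map_add, map_mul, map_pow, map_ofNat]; ring
  have taylor₆ : ∀ ρ : ℚ, ι (b₆ + 2 * ρ * b₄ + ρ ^ 2 * b₂ + 4 * ρ ^ 3) =
      B₆ + 2 * B₄ * (ι ρ - r) + B₂ * (ι ρ - r) ^ 2 + 4 * (ι ρ - r) ^ 3 := fun ρ ↦ by
    rw [hB₆def, hB₄def, hB₂def]; simp only [map_add, map_mul, map_pow, map_ofNat]; ring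
  -- Step 0: `r` is a `v`-integer
  have hr : v r ≤ 1 := by
    by_contra hlt
    rw [not_le] at hlt
    have hv4r : v (4 * r ^ 3) = v r ^ 3 := by rw [map_mul, map_pow, hv4, one_mul]
    have h1 : v (ι b₆) < v (4 * r ^ 3) := by
      rw [hv4r]; exact lt_of_le_of_lt hvb₆ (one_lt_pow₀ hlt three_ne_zero)
    have h2 : v (2 * r * ι b₄) < v (4 * r ^ 3) := by
      rw [hv4r, map_mul, map_mul, hv2, one_mul]
      calc v r * v (ι b₄) ≤ v r * 1 := mul_le_mul' le_rfl hvb₄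
        _ = v r ^ 1 := by rw [mul_one, pow_one]
        _ < v r ^ 3 := pow_lt_pow_right₀ hlt (by norm_num)
    have h3 : v (r ^ 2 * ι b₂) < v (4 * r ^ 3) := by
      rw [hv4r, map_mul, map_pow]
      calc v r ^ 2 * v (ι b₂) ≤ v r ^ 2 * 1 := mul_le_mul' le_rfl hvb₂
        _ = v r ^ 2 := mul_one _
        _ < v r ^ 3 := pow_lt_pow_right₀ hlt (by norm_num)
    have hsplit : B₆ = 4 * r ^ 3 + (ι b₆ + 2 * r * ι b₄ + r ^ 2 * ι b₂) := by rw [hB₆def]; ring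
    have hsum : v B₆ = v (4 * r ^ 3) := by
      rw [hsplit]
      exact v.map_add_eq_of_lt_left (v.map_add_lt (v.map_add_lt h1 h2) h3)
    have : (1 : ℤᵐ⁰) < v B₆ := by rw [hsum, hv4r]; exact one_lt_pow₀ hlt three_ne_zero
    exact absurd (lt_of_lt_of_le this (le_trans hB₆ hk3)) (lt_irrefl _)
  -- Main induction: rational approximations of `r` to order `exp(−2m)`, `m ≤ k`
  have key : ∀ m : ℕ, m ≤ k → ∃ ρ : ℚ, v₃ ρ ≤ 1 ∧ v (ι ρ - r) ≤ exp (-(2 * m : ℤ)) := by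
    intro m
    induction m with
    | zero =>
      intro _
      refine ⟨0, by simp, ?_⟩
      simpa using hr
    | succ m ih =>
      intro hmk
      obtain ⟨ρ, hρ, hρr⟩ := ih (by omega)
      have hmk' : m < k := by omega
      -- residue lift: `x = (ι ρ − r) / 3^m` is a `v`-integer, congruent to an integer `c`
      have h3L0 : (3 : L) ≠ 0 := fun h ↦ by
        have := hv3; rw [h, map_zero] at this; exact exp_ne_zero this.symm
      set x : L := (ι ρ - r) * ((3 : L) ^ m)⁻¹ with hxdef
      have hx3 : ι ρ - r = x * (3 : L) ^ m := by
        rw [hxdef, inv_mul_cancel_right₀ (pow_ne_zero _ h3L0)]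
      have hv3m : v ((3 : L) ^ m) = exp (-(2 * m : ℤ)) := by
        rw [map_pow, hv3, ← exp_nsmul]; congr 1; simp only [nsmul_eq_mul]; ring
      have hvx : v x ≤ 1 := by
        have h := hρr
        rw [hx3, map_mul, hv3m] at h
        have hne : exp (-(2 * m : ℤ)) ≠ 0 := exp_ne_zero
        calc v x = v x * exp (-(2 * m : ℤ)) * (exp (-(2 * m : ℤ)))⁻¹ := by
              rw [mul_inv_cancel_right₀ hne]
          _ ≤ exp (-(2 * m : ℤ)) * (exp (-(2 * m : ℤ)))⁻¹ := mul_le_mul' h le_rfl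
          _ = 1 := mul_inv_cancel₀ hne
      obtain ⟨c, hc⟩ := hres x hvx
      have hc' : v (x - ι c) ≤ exp (-1) := by
        have := le_exp_sub_one_of_lt_exp (n := 0) (by rwa [exp_zero])
        simpa using this
      -- the refined rational `ρ' = ρ − 3^m c` satisfies `v(ι ρ' − r) ≤ exp(−(2m+1))`
      set ρ' : ℚ := ρ - 3 ^ m * c with hρ'def
      have hρ' : v₃ ρ' ≤ 1 := by
        rw [hρ'def]
        refine le_trans (v₃.map_sub ρ _) (max_le hρ ?_)
        rw [map_mul, map_pow, h3]
        refine mul_le_one' (pow_le_one₀ zero_le ?_) (hint c)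
        rw [← exp_zero, exp_le_exp]; norm_num
      have hdiff : ι ρ' - r = (x - ι c) * (3 : L) ^ m := by
        rw [hρ'def, map_sub, map_mul, map_pow, map_ofNat, map_intCast, sub_mul, ← hx3]; ring
      have hρ'r : v (ι ρ' - r) ≤ exp (-(2 * m + 1 : ℤ)) := by
        rw [hdiff, map_mul, hv3m]
        calc v (x - ι ↑c) * exp (-(2 * m : ℤ)) ≤ exp (-1) * exp (-(2 * m : ℤ)) :=
              mul_le_mul' hc' le_rfl
          _ = exp (-(2 * m + 1 : ℤ)) := by rw [← exp_add]; congr 1; ring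
      refine ⟨ρ', hρ', ?_⟩
      -- parity step: `v(ι ρ' − r) = exp(−(2m+1))` exactly is impossible
      rcases hρ'r.lt_or_eq with hlt | heq
      · have := le_exp_sub_one_of_lt_exp hlt
        convert this using 2; push_cast; ring
      exfalso
      set δ : L := ι ρ' - r with hδdef
      -- valuations of the four Taylor terms of `g(ρ')`
      have hvδ3 : v (4 * δ ^ 3) = exp (-(6 * m + 3 : ℤ)) := by
        rw [map_mul, map_pow, hv4, one_mul, heq, ← exp_nsmul]; congr 1; simp only [nsmul_eq_mul]; push_cast; ring
      have ht1 : v B₆ < v (4 * δ ^ 3) := by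
        rw [hvδ3]; refine lt_of_le_of_lt hB₆ ?_; rw [exp_lt_exp]; omega
      have ht2 : v (2 * B₄ * δ) < v (4 * δ ^ 3) := by
        rw [hvδ3, map_mul, map_mul, hv2, one_mul, heq]
        calc v B₄ * exp (-(2 * m + 1 : ℤ)) ≤ exp (-(4 * k : ℤ)) * exp (-(2 * m + 1 : ℤ)) :=
              mul_le_mul' hB₄ le_rfl
          _ = exp (-(4 * k : ℤ) + -(2 * m + 1 : ℤ)) := (exp_add _ _).symm
          _ < exp (-(6 * m + 3 : ℤ)) := by rw [exp_lt_exp]; omega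
      have ht3 : v (B₂ * δ ^ 2) < v (4 * δ ^ 3) := by
        rw [hvδ3, map_mul, map_pow, heq, ← exp_nsmul]
        calc v B₂ * exp (2 • -(2 * m + 1 : ℤ)) ≤ exp (-(2 * k : ℤ)) * exp (2 • -(2 * m + 1 : ℤ)) :=
              mul_le_mul' hB₂ le_rfl
          _ = exp (-(2 * k : ℤ) + 2 • -(2 * m + 1 : ℤ)) := (exp_add _ _).symm
          _ < exp (-(6 * m + 3 : ℤ)) := by rw [exp_lt_exp]; simp only [nsmul_eq_mul]; push_cast; omega
      have hsplit : B₆ + 2 * B₄ * δ + B₂ * δ ^ 2 + 4 * δ ^ 3 =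
          4 * δ ^ 3 + (B₆ + 2 * B₄ * δ + B₂ * δ ^ 2) := by ring
      have hval : v (ι (b₆ + 2 * ρ' * b₄ + ρ' ^ 2 * b₂ + 4 * ρ' ^ 3)) = exp (-(6 * m + 3 : ℤ)) := by
        rw [taylor₆, ← hδdef, hsplit, v.map_add_eq_of_lt_left (v.map_add_lt (v.map_add_lt ht1 ht2) ht3),
          hvδ3]
      rw [hι] at hval
      exact sq_ne_exp_odd _ (-(3 * m + 2 : ℤ)) (by rw [hval]; congr 1; ring)
  -- Conclusion: transfer the bounds from `r` to the rational `ρ` with `v(ι ρ − r) ≤ exp(−2k)`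
  obtain ⟨ρ, hρ, hρr⟩ := key k le_rfl
  set δ : L := ι ρ - r with hδdef
  have hδ1 : v δ ≤ 1 := le_trans hρr (by rw [← exp_zero, exp_le_exp]; omega)
  refine ⟨ρ, hρ, ?_, ?_, ?_⟩
  · apply le_exp_of_sq_le_exp_two_mul
    rw [← hι, taylor₂, ← hδdef, show (2 * -(k : ℤ)) = -(2 * k : ℤ) by ring]
    refine v.map_add_le hB₂ ?_
    rw [map_mul]
    exact mul_le_of_le_one_of_le hv12 hρr
  · apply le_exp_of_sq_le_exp_two_mul
    rw [← hι, taylor₄, ← hδdef, show (2 * -(2 * k : ℤ)) = -(4 * k : ℤ) by ring]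
    refine v.map_add_le (v.map_add_le hB₄ ?_) ?_
    · rw [map_mul]
      calc v B₂ * v δ ≤ exp (-(2 * k : ℤ)) * exp (-(2 * k : ℤ)) := mul_le_mul' hB₂ hρr
        _ = exp (-(4 * k : ℤ)) := by rw [← exp_add]; congr 1; ring
    · rw [map_mul, map_pow]
      refine mul_le_of_le_one_of_le hv6 ?_
      calc v δ ^ 2 ≤ exp (-(2 * k : ℤ)) ^ 2 := pow_le_pow_left₀ zero_le hρr 2
        _ = exp (-(4 * k : ℤ)) := by rw [← exp_nsmul]; congr 1; simp only [nsmul_eq_mul]; push_cast; ring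
  · apply le_exp_of_sq_le_exp_two_mul
    rw [← hι, taylor₆, ← hδdef, show (2 * -(3 * k : ℤ)) = -(6 * k : ℤ) by ring]
    refine v.map_add_le (v.map_add_le (v.map_add_le hB₆ ?_) ?_) ?_
    · rw [map_mul, map_mul, hv2, one_mul]
      calc v B₄ * v δ ≤ exp (-(4 * k : ℤ)) * exp (-(2 * k : ℤ)) := mul_le_mul' hB₄ hρr
        _ = exp (-(6 * k : ℤ)) := by rw [← exp_add]; congr 1; ring
    · rw [map_mul, map_pow]
      calc v B₂ * v δ ^ 2 ≤ exp (-(2 * k : ℤ)) * exp (-(2 * k : ℤ)) ^ 2 :=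
            mul_le_mul' hB₂ (pow_le_pow_left₀ zero_le hρr 2)
        _ = exp (-(6 * k : ℤ)) := by rw [← exp_nsmul, ← exp_add]; congr 1; simp only [nsmul_eq_mul]; push_cast; ring
    · rw [map_mul, map_pow, hv4, one_mul]
      calc v δ ^ 3 ≤ exp (-(2 * k : ℤ)) ^ 3 := pow_le_pow_left₀ zero_le hρr 3
        _ = exp (-(6 * k : ℤ)) := by rw [← exp_nsmul]; congr 1; simp only [nsmul_eq_mul]; push_cast; ring

end ThreeAdicLift

end Summit.BirchSwinnertonDyer.Rank1Residual.Additive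

end
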